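import Mathlib.Analysis.SpecialFunctions.Pow.Real
import Mathlib.Analysis.SpecialFunctions.Log.Basic
import Mathlib.Algebra.Order.Floor.Defs
import Literature.Barriers.MatrixMultiplication.NilpotentGroupBarrier
import Literature.Computability.AlgebraicComplexity.GroupTheoreticMatMulThmBProofs
import HarnessLib

/-!
# Sawin 2018, Lemma 1.3 and Theorem 1.5 — proved

Topic `Literature/Barriers/MatrixMultiplication`; first proof file attached to the catalogue entry
`NilpotentGroupBarrier.lean` (Blasiak–Church–Cohn–Grochow–Umans 2017 / Sawin 2018), discharging
the two named facts of that file which come from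

* W. Sawin, *Bounds for matchings in nonabelian groups*, Electron. J. Combin. 25 (2018),
  arXiv:1702.00905 [Sawin2018]: Lemma 1.3 ("Let `G` be a finite group, and let `p` be a prime
  dividing `|G|`. There exists a constant `δ < 1` such that the slice rank of the multiplication
  tensor of `Gⁿ` over `𝔽_p` is at most `3δⁿ|G|ⁿ`") and Theorem 1.5 ("Let `G` be a nontrivial
  finite group. There exists a constant `δ < 1` such that any multiplicative matching in `Gⁿ` has
  size at most `δⁿ|G|ⁿ`"), p. 3 of the held text `paper:arxiv-1702.00905`.

Main results: `Sawin2018_lem13_holds : Sawin2018_lem13` and `Sawin2018_thm15_holds :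
Sawin2018_thm15` (the facts are stated in `NilpotentGroupBarrier.lean` for the tensor
`D_G(x,y,z) = [xyz = 1] = mulGroupTensor`, which has the same slice rank as the multiplication
tensor, `sliceRank_groupTensor` there).

## The proof

Sawin proves Lemma 1.3 through Lemma 1.1 (a square-zero two-sided ideal `I` of an algebra `R`
makes the multiplication tensor unstable with instability `≥ dim I / (3 dim R)`) and the
instability bound for tensor powers of BCCGNSU 2017 (Thm. 4.10 / Prop. 4.12), applied to
`R = 𝔽_p[G]` and `I = 𝔽_p σ`, `σ = Σ_g g` (`σ² = |G|σ = 0`). We prove the same statement by the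
same mechanism written out in coordinates, which keeps everything inside finite sums:

* **Adapted basis.** `β_g = g` (`g ≠ 1`), `β_1 = σ`; transition matrices `sawinP`, `sawinQ`
  (`Q P = 1`, `sum_sawinQ_mul_sawinP`), structure constants `γ(g,h;l)` of `K[G]` in this basis
  (`sawinGamma`) and their **grading** by `deg β_1 = 1`, `deg β_g = 0`: `γ(g,h;l) ≠ 0 ⟹
  deg g + deg h ≤ deg l` when `char K ∣ |G|` (`sawinGamma_graded`: `σσ = 0`, `σh = gσ = σ`) —
  this is Sawin's `u_a + v_b + w_c ≤ 1` support condition of Lemma 1.1 for `I = Kσ`.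
* **Tensor power.** For a finite index set `T` the tensor basis of `K[G^T] = K[G]^{⊗T}` has
  transition matrices `∏_t P`, `∏_t Q` and structure constants `c' = ∏_t γ` (`sawinC_eq_prod`,
  by `Fintype.prod_sum`), graded by `deg i = #{t : i_t = 1}` (`sawinC_graded`).
* **Change of basis.** `D_{G^T}(x,y,z) = Σ_k P(k,z⁻¹) Σ_j Q(y,j) Σ_i Q(x,i) c'(i,j;k)`
  (`mulGroupTensor_pi_eq_subst`), and linear substitutions in each leg do not increase slice rank
  (`HasSliceRankLE.subst_left/mid/right`; BCCGU 2017, §2.3: slice rank is invariant under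
  `GL × GL × GL`).
* **Graded slice-rank bound** (BCCGU 2017, Prop. 3.2 in coordinates = the batching in Sawin's
  Lemma 2.1): a tensor supported on `deg x + deg y ≤ deg z` has slice rank
  `≤ #{deg x < a} + #{deg y < b} + #{deg z ≥ a+b}` (`HasSliceRankLE.of_graded`). With `a = b`:
  `slice-rank D_{G^T} ≤ 2#{deg < a} + #{deg ≥ 2a}` (`hasSliceRankLE_mulGroupTensor_pi`).
* **Exponential moments** instead of the KL-divergence/Hoeffding constant of BCCGNSU Thm. 4.10:
  `Σ_i r^{deg i} = (r + |G| - 1)^{|T|}`, so `#{deg < a} ≤ r^{1-a}(r+|G|-1)^{|T|}` (`r ≤ 1`) and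
  `#{deg ≥ 2a} ≤ R^{-2a}(R+|G|-1)^{|T|}` (`R ≥ 1`); with `q = 1/|G|`, `a = ⌈3q|T|/4⌉`,
  `r = 7/8`, `R = 5/4` both tails are `≤ δᵢ^{|T|}|G|^{|T|}` with
  `δ₁ = (7/8)^{-3q/4}(1-q/8) < 1`, `δ₂ = (5/4)^{-3q/2}(1+q/4) < 1` (`exp x ≥ 1 + x`,
  `log x ≥ 1 - 1/x`). Hence `slice-rank D_{G^T} ≤ 3 δ^{|T|} |G|^{|T|}`, `δ = max(δ₁, δ₂) ∈ (0,1)`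
  depending only on `|G|` (`exists_sliceRank_mulGroupTensor_pi_le`; Lemma 1.3 is `T = Fin n`).
* **Theorem 1.5** as printed: `p ∣ |G|` exists since `G` is non-trivial; a matching in `Gⁿ`
  indexed by `ι` gives one in `G^{k×n}` indexed by `ι^k` (`IsMulMatching.pow`); Lemma 1.4 =
  BCCGU Prop. 2.10 (`IsMulMatching.card_le_sliceRank`, proved in `NilpotentGroupBarrier.lean`)
  gives `|ι|^k ≤ 3(δⁿ|G|ⁿ)^k` for all `k ≥ 1`, whence `|ι| ≤ δⁿ|G|ⁿ`
  (`le_of_pow_le_poly_mul_pow`).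

Secondary source for the slice-rank lemmas: J. Blasiak, T. Church, H. Cohn, J. A. Grochow,
C. Umans, *Which groups are amenable to proving exponent two for matrix multiplication?*,
arXiv:1712.02302 [BlasiakChurchCohnGrochowUmans2017], §2.3 (change of basis), Lemma 3.1 and
Prop. 3.2 (codimension bound).

Last section (audit 2026-08-17, gen 2 — the lower-bound side): BCCGU 2017, App. A, Lemma A.5
(multiplicative matchings compose along extensions `1 → N → G → G/N → 1`, honest form) PROVED as
`IsMulMatching.extension`, with `|A|·|L| ≤ slice-rank_K D_G`
(`IsMulMatching.card_mul_le_sliceRank_of_extension`): together with the Kleinberg–Sawin–Speyer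
capacities of cyclic groups it caps how small any Sawin-type `δ` can be for a fixed solvable `G`
(section docstring there).
-/

noncomputable section

open scoped BigOperators
open Finset

namespace Literature.Barriers.MatrixMultiplication

open Literature.Combinatorics.Additive

universe u v

/-! ## A graded slice-rank bound (BCCGU 2017, Prop. 3.2 in coordinates) -/

section Graded

variable {K : Type v} [Field K] {X Y Z : Type*}

/-- **Graded slice-rank bound** (the coordinate form of Blasiak–Church–Cohn–Grochow–Umans 2017,
Prop. 3.2 / Lemma 3.3, and of Sawin 2018, Lemma 2.1): if a tensor `T` vanishes unless
`dx x + dy y ≤ dz z`, then for all thresholds `a, b`,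
`slice-rank T ≤ #{x : dx x < a} + #{y : dy y < b} + #{z : a + b ≤ dz z}`: slice along `x` where
`dx x < a`, along `y` where `dy y < b`, and the rest is supported on `dz z ≥ a + b`.
[cite: BlasiakChurchCohnGrochowUmans2017, Prop. 3.2] -/
theorem _root_.Literature.Combinatorics.Additive.HasSliceRankLE.of_graded [Fintype X] [Fintype Y]
    [Fintype Z] [DecidableEq X] [DecidableEq Y] [DecidableEq Z] (T : X → Y → Z → K)
    (dx : X → ℕ) (dy : Y → ℕ) (dz : Z → ℕ) (hT : ∀ x y z, T x y z ≠ 0 → dx x + dy y ≤ dz z)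
    (a b : ℕ) :
    HasSliceRankLE T (Fintype.card {x // dx x < a} + Fintype.card {y // dy y < b} +
      Fintype.card {z // a + b ≤ dz z}) := by
  classical
  refine hasSliceRankLE_of_fintype T
    (fun (x₀ : {x // dx x < a}) x => if x = x₀.1 then 1 else 0) (fun x₀ y z => T x₀.1 y z)
    (fun (y₀ : {y // dy y < b}) y => if y = y₀.1 then 1 else 0)
    (fun y₀ x z => if dx x < a then 0 else T x y₀.1 z)
    (fun (z₀ : {z // a + b ≤ dz z}) z => if z = z₀.1 then 1 else 0)
    (fun z₀ x y => if dx x < a ∨ dy y < b then 0 else T x y z₀.1) fun x y z => ?_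
  -- each of the three sums has at most one non-zero term
  have h1 : ∑ x₀ : {x // dx x < a}, (if x = x₀.1 then (1 : K) else 0) * T x₀.1 y z =
      if dx x < a then T x y z else 0 := by
    split_ifs with hx
    · rw [Finset.sum_eq_single ⟨x, hx⟩]
      · simp
      · rintro ⟨x₀, hx₀⟩ _ hne
        have : x ≠ x₀ := fun h => hne (Subtype.ext h.symm)
        simp [this]
      · simp
    · refine Finset.sum_eq_zero fun x₀ _ => ?_
      have : x ≠ x₀.1 := fun h => hx (h ▸ x₀.2)
      simp [this]
  have h2 : ∑ y₀ : {y // dy y < b}, (if y = y₀.1 then (1 : K) else 0) *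
      (if dx x < a then 0 else T x y₀.1 z) =
      if dx x < a then 0 else if dy y < b then T x y z else 0 := by
    by_cases hx : dx x < a
    · simp [hx]
    · simp only [hx, if_false]
      split_ifs with hy
      · rw [Finset.sum_eq_single ⟨y, hy⟩]
        · simp
        · rintro ⟨y₀, hy₀⟩ _ hne
          have : y ≠ y₀ := fun h => hne (Subtype.ext h.symm)
          simp [this]
        · simp
      · refine Finset.sum_eq_zero fun y₀ _ => ?_
        have : y ≠ y₀.1 := fun h => hy (h ▸ y₀.2)
        simp [this]
  have h3 : ∑ z₀ : {z // a + b ≤ dz z}, (if z = z₀.1 then (1 : K) else 0) *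
      (if dx x < a ∨ dy y < b then 0 else T x y z₀.1) =
      if dx x < a ∨ dy y < b then 0 else T x y z := by
    split_ifs with hxy
    · simp
    · by_cases hz : a + b ≤ dz z
      · rw [Finset.sum_eq_single ⟨z, hz⟩]
        · simp
        · rintro ⟨z₀, hz₀⟩ _ hne
          have : z ≠ z₀ := fun h => hne (Subtype.ext h.symm)
          simp [this]
        · simp
      · -- here `T x y z = 0` by the grading
        have hT0 : T x y z = 0 := by
          by_contra hne
          have := hT x y z hne
          push Not at hxy hz
          omega
        rw [hT0]
        refine Finset.sum_eq_zero fun z₀ _ => ?_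
        have : z ≠ z₀.1 := fun h => hz (h ▸ z₀.2)
        simp [this]
  rw [h1, h2, h3]
  by_cases hx : dx x < a
  · simp [hx]
  · by_cases hy : dy y < b
    · simp [hx, hy]
    · simp [hx, hy]

end Graded

/-! ## Linear substitutions on the three legs do not increase the slice rank -/

section Subst

variable {K : Type v} [Field K] {X Y Z : Type*}

/-- Slice decompositions are stable under a linear substitution in the first leg: if `D` has a
`k`-slice decomposition then so has `(x',y,z) ↦ Σ_x P(x',x) D(x,y,z)` ("the slice rank is
invariant under change of basis in each of the three factors", BCCGU 2017, §2.3; only this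
monotonicity is needed). [cite: BlasiakChurchCohnGrochowUmans2017, §2.3] -/
theorem _root_.Literature.Combinatorics.Additive.HasSliceRankLE.subst_left [Fintype X]
    {D : X → Y → Z → K} {k : ℕ} (h : HasSliceRankLE D k) {X' : Type*} (P : X' → X → K) :
    HasSliceRankLE (fun x' y z => ∑ x, P x' x * D x y z) k := by
  obtain ⟨kx, ky, kz, hk, f₁, g₁, f₂, g₂, f₃, g₃, hD⟩ := h
  refine ⟨kx, ky, kz, hk, fun r x' => ∑ x, P x' x * f₁ r x, g₁, f₂,
    fun r x' z => ∑ x, P x' x * g₂ r x z, f₃, fun r x' y => ∑ x, P x' x * g₃ r x y,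
    fun x' y z => ?_⟩
  have e1 : ∑ x, P x' x * ∑ r, f₁ r x * g₁ r y z = ∑ r, (∑ x, P x' x * f₁ r x) * g₁ r y z := by
    simp_rw [Finset.mul_sum, Finset.sum_mul]
    rw [Finset.sum_comm]
    exact Finset.sum_congr rfl fun r _ => Finset.sum_congr rfl fun x _ => by ring
  have e2 : ∑ x, P x' x * ∑ r, f₂ r y * g₂ r x z = ∑ r, f₂ r y * ∑ x, P x' x * g₂ r x z := by
    simp_rw [Finset.mul_sum]
    rw [Finset.sum_comm]
    exact Finset.sum_congr rfl fun r _ => Finset.sum_congr rfl fun x _ => by ring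
  have e3 : ∑ x, P x' x * ∑ r, f₃ r z * g₃ r x y = ∑ r, f₃ r z * ∑ x, P x' x * g₃ r x y := by
    simp_rw [Finset.mul_sum]
    rw [Finset.sum_comm]
    exact Finset.sum_congr rfl fun r _ => Finset.sum_congr rfl fun x _ => by ring
  simp only
  simp_rw [hD, mul_add, Finset.sum_add_distrib, e1, e2, e3]

/-- Linear substitution in the second leg (see `HasSliceRankLE.subst_left`).
[cite: BlasiakChurchCohnGrochowUmans2017, §2.3] -/
theorem _root_.Literature.Combinatorics.Additive.HasSliceRankLE.subst_mid [Fintype Y]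
    {D : X → Y → Z → K} {k : ℕ} (h : HasSliceRankLE D k) {Y' : Type*} (Q : Y' → Y → K) :
    HasSliceRankLE (fun x y' z => ∑ y, Q y' y * D x y z) k := by
  obtain ⟨kx, ky, kz, hk, f₁, g₁, f₂, g₂, f₃, g₃, hD⟩ := h
  refine ⟨kx, ky, kz, hk, f₁, fun r y' z => ∑ y, Q y' y * g₁ r y z, fun r y' => ∑ y, Q y' y * f₂ r y,
    g₂, f₃, fun r x y' => ∑ y, Q y' y * g₃ r x y, fun x y' z => ?_⟩
  have e1 : ∑ y, Q y' y * ∑ r, f₁ r x * g₁ r y z = ∑ r, f₁ r x * ∑ y, Q y' y * g₁ r y z := by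
    simp_rw [Finset.mul_sum]
    rw [Finset.sum_comm]
    exact Finset.sum_congr rfl fun r _ => Finset.sum_congr rfl fun y _ => by ring
  have e2 : ∑ y, Q y' y * ∑ r, f₂ r y * g₂ r x z = ∑ r, (∑ y, Q y' y * f₂ r y) * g₂ r x z := by
    simp_rw [Finset.mul_sum, Finset.sum_mul]
    rw [Finset.sum_comm]
    exact Finset.sum_congr rfl fun r _ => Finset.sum_congr rfl fun y _ => by ring
  have e3 : ∑ y, Q y' y * ∑ r, f₃ r z * g₃ r x y = ∑ r, f₃ r z * ∑ y, Q y' y * g₃ r x y := by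
    simp_rw [Finset.mul_sum]
    rw [Finset.sum_comm]
    exact Finset.sum_congr rfl fun r _ => Finset.sum_congr rfl fun y _ => by ring
  simp only
  simp_rw [hD, mul_add, Finset.sum_add_distrib, e1, e2, e3]

/-- Linear substitution in the third leg (see `HasSliceRankLE.subst_left`).
[cite: BlasiakChurchCohnGrochowUmans2017, §2.3] -/
theorem _root_.Literature.Combinatorics.Additive.HasSliceRankLE.subst_right [Fintype Z]
    {D : X → Y → Z → K} {k : ℕ} (h : HasSliceRankLE D k) {Z' : Type*} (R : Z' → Z → K) :
    HasSliceRankLE (fun x y z' => ∑ z, R z' z * D x y z) k := by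
  obtain ⟨kx, ky, kz, hk, f₁, g₁, f₂, g₂, f₃, g₃, hD⟩ := h
  refine ⟨kx, ky, kz, hk, f₁, fun r y z' => ∑ z, R z' z * g₁ r y z, f₂,
    fun r x z' => ∑ z, R z' z * g₂ r x z, fun r z' => ∑ z, R z' z * f₃ r z, g₃, fun x y z' => ?_⟩
  have e1 : ∑ z, R z' z * ∑ r, f₁ r x * g₁ r y z = ∑ r, f₁ r x * ∑ z, R z' z * g₁ r y z := by
    simp_rw [Finset.mul_sum]
    rw [Finset.sum_comm]
    exact Finset.sum_congr rfl fun r _ => Finset.sum_congr rfl fun z _ => by ring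
  have e2 : ∑ z, R z' z * ∑ r, f₂ r y * g₂ r x z = ∑ r, f₂ r y * ∑ z, R z' z * g₂ r x z := by
    simp_rw [Finset.mul_sum]
    rw [Finset.sum_comm]
    exact Finset.sum_congr rfl fun r _ => Finset.sum_congr rfl fun z _ => by ring
  have e3 : ∑ z, R z' z * ∑ r, f₃ r z * g₃ r x y = ∑ r, (∑ z, R z' z * f₃ r z) * g₃ r x y := by
    simp_rw [Finset.mul_sum, Finset.sum_mul]
    rw [Finset.sum_comm]
    exact Finset.sum_congr rfl fun r _ => Finset.sum_congr rfl fun z _ => by ring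
  simp only
  simp_rw [hD, mul_add, Finset.sum_add_distrib, e1, e2, e3]

end Subst

/-! ## The adapted basis of `K[G]` and of `K[G^T]` (Sawin 2018, proof of Lemma 1.3) -/

section SawinBasis

variable {K : Type v} [Field K] {G : Type u} [Group G] [DecidableEq G] [Fintype G]

/-- Transition matrix of the adapted basis `β_g` of `K[G]` (`β_g = g` for `g ≠ 1`,
`β_1 = σ = Σ_x x`, the generator of the square-zero two-sided ideal `Kσ` when `char K ∣ |G|`,
Sawin 2018, proof of Lemma 1.3): `β_g = Σ_x sawinP g x · x`. [cite: Sawin2018, Lemma 1.3 (proof)] -/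
def sawinP (g x : G) : K :=
  if g = 1 then 1 else if x = g then 1 else 0

/-- Inverse transition matrix: `x = Σ_g sawinQ x g · β_g` (`x = β_x` for `x ≠ 1`,
`1 = σ - Σ_{g ≠ 1} β_g`). [cite: Sawin2018, Lemma 1.3 (proof)] -/
def sawinQ (x g : G) : K :=
  if x = 1 then (if g = 1 then 1 else -1) else if g = x then 1 else 0

omit [Fintype G] in
/-- `sawinP 1 x = 1`. [folklore] -/
@[simp] theorem sawinP_one (x : G) : (sawinP 1 x : K) = 1 := by simp [sawinP]

omit [Fintype G] in
/-- `sawinP g x = [x = g]` for `g ≠ 1`. [folklore] -/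
theorem sawinP_of_ne_one {g : G} (hg : g ≠ 1) (x : G) :
    (sawinP g x : K) = if x = g then 1 else 0 := by simp [sawinP, hg]

/-- `Q P = 1`: `Σ_g sawinQ a g · sawinP g b = [a = b]`. [folklore] -/
theorem sum_sawinQ_mul_sawinP (a b : G) :
    ∑ g, (sawinQ a g * sawinP g b : K) = if a = b then 1 else 0 := by
  by_cases ha : a = 1
  · subst ha
    rw [← Finset.add_sum_erase _ _ (Finset.mem_univ (1 : G))]
    have h1 : ∑ g ∈ (Finset.univ.erase (1 : G)), (sawinQ (1 : G) g * sawinP g b : K) =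
        ∑ g ∈ (Finset.univ.erase (1 : G)), (if b = g then (-1 : K) else 0) := by
      refine Finset.sum_congr rfl fun g hg => ?_
      have hg1 : g ≠ 1 := Finset.ne_of_mem_erase hg
      simp [sawinQ, sawinP, hg1]
    rw [h1, Finset.sum_ite_eq]
    by_cases hb : b = 1
    · subst hb; simp [sawinQ, sawinP]
    · simp [sawinQ, sawinP, hb, Ne.symm hb]
  · have h1 : ∀ g, (sawinQ a g * sawinP g b : K) = if g = a then sawinP g b else 0 := by
      intro g; simp [sawinQ, ha]
    simp_rw [h1, Finset.sum_ite_eq', Finset.mem_univ, if_true, sawinP_of_ne_one ha]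
    by_cases hab : a = b
    · simp [hab]
    · simp [hab, Ne.symm hab]

/-- Column sums of `Q`: `Σ_z sawinQ z l = [l = 1]`. [folklore] -/
theorem sum_sawinQ (l : G) : ∑ z, (sawinQ z l : K) = if l = 1 then 1 else 0 := by
  rw [← Finset.add_sum_erase _ _ (Finset.mem_univ (1 : G))]
  have h1 : ∑ z ∈ (Finset.univ.erase (1 : G)), (sawinQ z l : K) =
      ∑ z ∈ (Finset.univ.erase (1 : G)), (if l = z then (1 : K) else 0) := by
    refine Finset.sum_congr rfl fun z hz => ?_
    have hz1 : z ≠ 1 := Finset.ne_of_mem_erase hz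
    simp [sawinQ, hz1]
  rw [h1, Finset.sum_ite_eq]
  by_cases hl : l = 1
  · subst hl; simp [sawinQ]
  · simp [sawinQ, hl]

/-- `Σ_h sawinQ (g h) l = Σ_z sawinQ z l`. [folklore] -/
theorem sum_sawinQ_mul_left (g l : G) : ∑ h, (sawinQ (g * h) l : K) = if l = 1 then 1 else 0 := by
  rw [← sum_sawinQ l]
  exact Fintype.sum_equiv (Equiv.mulLeft g) _ _ fun _ => rfl

/-- The structure constants `γ(g,h;l)` of `K[G]` in the adapted basis `β`:
`β_g β_h = Σ_l γ(g,h;l) β_l`, `γ(g,h;l) = Σ_{x,y} P(g,x) P(h,y) Q(xy,l)`.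
[cite: Sawin2018, Lemma 1.3 (proof)] -/
def sawinGamma (g h l : G) : K :=
  ∑ x, sawinP g x * ∑ y, sawinP h y * sawinQ (x * y) l

/-- `σ · σ = |G| σ = 0` when `char K ∣ |G|`: `γ(1,1;l) = 0`. [cite: Sawin2018, Lemma 1.3 (proof)] -/
theorem sawinGamma_one_one (hG : (Fintype.card G : K) = 0) (l : G) :
    (sawinGamma 1 1 l : K) = 0 := by
  simp only [sawinGamma, sawinP_one, one_mul, sum_sawinQ_mul_left, Finset.sum_const,
    Finset.card_univ, nsmul_eq_mul, hG, zero_mul]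

/-- `σ · h = σ`: `γ(1,h;l) = [l = 1]` for `h ≠ 1`. [cite: Sawin2018, Lemma 1.3 (proof)] -/
theorem sawinGamma_one_left {h : G} (hh : h ≠ 1) (l : G) :
    (sawinGamma 1 h l : K) = if l = 1 then 1 else 0 := by
  simp only [sawinGamma, sawinP_one, one_mul, sawinP_of_ne_one hh, ite_mul, zero_mul,
    Finset.sum_ite_eq', Finset.mem_univ, if_true]
  rw [← sum_sawinQ l]
  exact Fintype.sum_equiv (Equiv.mulRight h) _ _ fun _ => rfl

/-- `g · σ = σ`: `γ(g,1;l) = [l = 1]` for `g ≠ 1`. [cite: Sawin2018, Lemma 1.3 (proof)] -/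
theorem sawinGamma_one_right {g : G} (hg : g ≠ 1) (l : G) :
    (sawinGamma g 1 l : K) = if l = 1 then 1 else 0 := by
  simp only [sawinGamma, sawinP_one, one_mul, sawinP_of_ne_one hg, ite_mul, zero_mul,
    Finset.sum_ite_eq', Finset.mem_univ, if_true, sum_sawinQ_mul_left]

/-- The degree of a basis vector `β_g`: `1` for `σ = β_1`, `0` otherwise. [cite: Sawin2018, Lemma 1.3 (proof)] -/
def degOne (g : G) : ℕ := if g = 1 then 1 else 0

omit [Fintype G] in
/-- `degOne g ≤ 1`. [folklore] -/
theorem degOne_le_one (g : G) : degOne g ≤ 1 := by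
  unfold degOne; split_ifs <;> simp

/-- **Grading of `K[G]` by the square-zero ideal `Kσ`** (`char K ∣ |G|`): `γ(g,h;l) ≠ 0` forces
`deg g + deg h ≤ deg l`. [cite: Sawin2018, Lemma 1.3 (proof)] -/
theorem sawinGamma_graded (hG : (Fintype.card G : K) = 0) (g h l : G)
    (hne : (sawinGamma g h l : K) ≠ 0) : degOne g + degOne h ≤ degOne l := by
  unfold degOne
  by_cases hg : g = 1
  · subst hg
    by_cases hh : h = 1
    · subst hh; exact absurd (sawinGamma_one_one hG l) hne
    · rw [sawinGamma_one_left hh] at hne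
      have hl : l = 1 := by by_contra hl; simp [hl] at hne
      simp [hh, hl]
  · by_cases hh : h = 1
    · subst hh
      rw [sawinGamma_one_right hg] at hne
      have hl : l = 1 := by by_contra hl; simp [hl] at hne
      simp [hg, hl]
    · simp [hg, hh]

/-! ### The power `G^T` -/

variable {T : Type*} [Fintype T] [DecidableEq T]

/-- Transition matrix of the tensor basis `β_i = ⊗_t β_{i_t}` of `K[G^T]`. [cite: Sawin2018, Lemma 1.3 (proof)] -/
def sawinPT (i x : T → G) : K := ∏ t, sawinP (i t) (x t)

/-- Inverse transition matrix for `K[G^T]`. [cite: Sawin2018, Lemma 1.3 (proof)] -/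
def sawinQT (x i : T → G) : K := ∏ t, sawinQ (x t) (i t)

/-- Structure constants of `K[G^T]` in the tensor basis. [cite: Sawin2018, Lemma 1.3 (proof)] -/
def sawinC (i j k : T → G) : K :=
  ∑ x, sawinPT i x * ∑ y, sawinPT j y * sawinQT (x * y) k

/-- Degree of a tensor basis vector: the number of `σ`-factors. [cite: Sawin2018, Lemma 1.3 (proof)] -/
def sawinDeg (i : T → G) : ℕ := ∑ t, degOne (i t)

/-- `Q P = 1` for `G^T`. [folklore] -/
theorem sum_sawinQT_mul_sawinPT (a b : T → G) :
    ∑ i, (sawinQT a i * sawinPT i b : K) = if a = b then 1 else 0 := by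
  have h1 : ∀ i : T → G, (sawinQT a i * sawinPT i b : K) =
      ∏ t, (sawinQ (a t) (i t) * sawinP (i t) (b t)) := fun i => by
    rw [sawinQT, sawinPT, ← Finset.prod_mul_distrib]
  simp_rw [h1]
  rw [← Fintype.prod_sum (fun t g => (sawinQ (a t) g * sawinP g (b t) : K))]
  simp_rw [sum_sawinQ_mul_sawinP]
  rw [Finset.prod_boole]
  simp [funext_iff]

/-- The structure constants of `K[G^T]` are products of those of `K[G]`
(`K[G^T] = K[G]^{⊗T}`). [cite: Sawin2018, Lemma 1.3 (proof)] -/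
theorem sawinC_eq_prod (i j k : T → G) :
    (sawinC i j k : K) = ∏ t, sawinGamma (i t) (j t) (k t) := by
  have h1 : (sawinC i j k : K) = ∑ x : T → G, ∑ y : T → G,
      ∏ t, (sawinP (i t) (x t) * (sawinP (j t) (y t) * sawinQ (x t * y t) (k t))) := by
    unfold sawinC
    refine Finset.sum_congr rfl fun x _ => ?_
    rw [Finset.mul_sum]
    refine Finset.sum_congr rfl fun y _ => ?_
    rw [sawinPT, sawinPT, sawinQT, ← Finset.prod_mul_distrib, ← Finset.prod_mul_distrib]
    rfl
  rw [h1]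
  have h2 : ∀ x : T → G, ∑ y : T → G,
      ∏ t, (sawinP (i t) (x t) * (sawinP (j t) (y t) * sawinQ (x t * y t) (k t)) : K) =
      ∏ t, ∑ h, sawinP (i t) (x t) * (sawinP (j t) h * sawinQ (x t * h) (k t)) := fun x =>
    (Fintype.prod_sum (fun t h => (sawinP (i t) (x t) * (sawinP (j t) h * sawinQ (x t * h) (k t)) : K))).symm
  simp_rw [h2]
  rw [← Fintype.prod_sum (fun t g => ∑ h, (sawinP (i t) g * (sawinP (j t) h * sawinQ (g * h) (k t)) : K))]
  refine Finset.prod_congr rfl fun t _ => ?_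
  unfold sawinGamma
  simp_rw [Finset.mul_sum]

/-- **Grading of `K[G^T]`**: `c'(i,j;k) ≠ 0` forces `deg i + deg j ≤ deg k`.
[cite: Sawin2018, Lemma 1.3 (proof)] -/
theorem sawinC_graded (hG : (Fintype.card G : K) = 0) (i j k : T → G)
    (hne : (sawinC i j k : K) ≠ 0) : sawinDeg i + sawinDeg j ≤ sawinDeg k := by
  rw [sawinC_eq_prod, Finset.prod_ne_zero_iff] at hne
  unfold sawinDeg
  rw [← Finset.sum_add_distrib]
  exact Finset.sum_le_sum fun t _ => sawinGamma_graded hG _ _ _ (hne t (Finset.mem_univ t))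

/-- Contraction against `Q`: `Σ_i Q(x,i) Σ_{x'} P(i,x') F(x') = F(x)`. [folklore] -/
theorem sum_sawinQT_mul_sum (x : T → G) (F : (T → G) → K) :
    ∑ i, sawinQT x i * ∑ x', sawinPT i x' * F x' = F x := by
  simp_rw [Finset.mul_sum, ← mul_assoc]
  rw [Finset.sum_comm]
  simp_rw [← Finset.sum_mul, sum_sawinQT_mul_sawinPT, ite_mul, one_mul, zero_mul,
    Finset.sum_ite_eq, Finset.mem_univ, if_true]

/-- **`D_{G^T}` in the adapted tensor basis**: the group tensor `[xyz = 1]` is obtained from the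
structure constants `c'` by the substitutions `Q` (legs `x`, `y`) and `k ↦ P(k, z⁻¹)` (leg `z`).
[cite: Sawin2018, Lemma 1.3 (proof)] -/
theorem mulGroupTensor_pi_eq_subst :
    mulGroupTensor K (T → G) = fun x y z =>
      ∑ k, sawinPT k z⁻¹ * ∑ j, sawinQT y j * ∑ i, sawinQT x i * sawinC i j k := by
  funext x y z
  have h1 : ∀ j k : T → G, ∑ i, sawinQT x i * (sawinC i j k : K) =
      ∑ y', sawinPT j y' * sawinQT (x * y') k := fun j k => sum_sawinQT_mul_sum x _
  simp_rw [h1]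
  have h2 : ∀ k : T → G, ∑ j, sawinQT y j * ∑ y', sawinPT j y' * (sawinQT (x * y') k : K) =
      sawinQT (x * y) k := fun k => sum_sawinQT_mul_sum y (fun y' => sawinQT (x * y') k)
  simp_rw [h2, mul_comm (sawinPT _ _) (sawinQT _ _), sum_sawinQT_mul_sawinPT, mulGroupTensor_apply,
    eq_inv_iff_mul_eq_one]

/-- **Sawin 2018, Lemma 1.3, combinatorial core**: over a field whose characteristic divides
`|G|`, for every threshold `a`,
`slice-rank D_{G^T} ≤ 2 #{i ∈ G^T : deg i < a} + #{k ∈ G^T : deg k ≥ 2a}` (deg = number of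
coordinates equal to `1`, i.e. of `σ`-factors in the adapted tensor basis).
[cite: Sawin2018, Lemma 1.3] -/
theorem hasSliceRankLE_mulGroupTensor_pi (hG : (Fintype.card G : K) = 0) (a : ℕ) :
    HasSliceRankLE (mulGroupTensor K (T → G))
      (Fintype.card {i : T → G // sawinDeg i < a} + Fintype.card {i : T → G // sawinDeg i < a} +
        Fintype.card {k : T → G // a + a ≤ sawinDeg k}) := by
  rw [mulGroupTensor_pi_eq_subst]
  exact (((HasSliceRankLE.of_graded (sawinC (K := K)) sawinDeg sawinDeg sawinDeg
    (sawinC_graded hG) a a).subst_left sawinQT).subst_mid sawinQT).subst_right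
    (fun z k => sawinPT k z⁻¹)

end SawinBasis

/-! ## Counting basis vectors by degree (exponential moments) -/

section Counting

variable {G : Type u} [Group G] [DecidableEq G] [Fintype G] {T : Type*} [Fintype T] [DecidableEq T]

/-- Generating function of the degree: `Σ_{i ∈ G^T} r^{deg i} = (r + |G| - 1)^{|T|}`. [folklore] -/
theorem sum_pow_sawinDeg (r : ℝ) :
    ∑ i : T → G, r ^ sawinDeg i = (r + (Fintype.card G - 1)) ^ Fintype.card T := by
  have h1 : ∀ i : T → G, r ^ sawinDeg i = ∏ t, (if i t = 1 then r else 1) := fun i => by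
    rw [sawinDeg, ← Finset.prod_pow_eq_pow_sum]
    refine Finset.prod_congr rfl fun t _ => ?_
    unfold degOne
    split_ifs <;> simp
  simp_rw [h1]
  rw [← Fintype.prod_sum (fun (_ : T) (g : G) => (if g = 1 then r else 1)), Finset.prod_const,
    Finset.card_univ]
  congr 1
  have h2 : ∀ g : G, (if g = 1 then r else (1 : ℝ)) = 1 + (if g = 1 then r - 1 else 0) := by
    intro g; split_ifs <;> ring
  simp_rw [h2, Finset.sum_add_distrib, Finset.sum_ite_eq', Finset.mem_univ, if_true,
    Finset.sum_const, Finset.card_univ, nsmul_eq_mul, mul_one]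
  ring

/-- Lower tail: `#{i : deg i < a} ≤ r^{1-a} (r + |G| - 1)^{|T|}` for `0 < r ≤ 1`. [folklore] -/
theorem card_sawinDeg_lt_le {r : ℝ} (hr0 : 0 < r) (hr1 : r ≤ 1) (a : ℕ) :
    (Fintype.card {i : T → G // sawinDeg i < a} : ℝ) ≤
      r ^ ((1 : ℝ) - a) * (r + (Fintype.card G - 1)) ^ Fintype.card T := by
  classical
  rw [Fintype.card_subtype, ← sum_pow_sawinDeg r, Finset.mul_sum]
  have h1 : ((Finset.univ.filter fun i : T → G => sawinDeg i < a).card : ℝ) =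
      ∑ i : T → G, if sawinDeg i < a then (1 : ℝ) else 0 := by
    rw [Finset.sum_boole]
  rw [h1]
  refine Finset.sum_le_sum fun i _ => ?_
  split_ifs with hi
  · rw [← Real.rpow_natCast, ← Real.rpow_add hr0]
    refine Real.one_le_rpow_of_pos_of_le_one_of_nonpos hr0 hr1 ?_
    have : (sawinDeg i : ℝ) + 1 ≤ a := by exact_mod_cast hi
    linarith
  · positivity

/-- Upper tail: `#{k : m ≤ deg k} ≤ R^{-m} (R + |G| - 1)^{|T|}` for `1 ≤ R`. [folklore] -/
theorem card_le_sawinDeg_le {R : ℝ} (hR : 1 ≤ R) (m : ℕ) :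
    (Fintype.card {k : T → G // m ≤ sawinDeg k} : ℝ) ≤
      R ^ (-(m : ℝ)) * (R + (Fintype.card G - 1)) ^ Fintype.card T := by
  classical
  have hR0 : 0 < R := by linarith
  rw [Fintype.card_subtype, ← sum_pow_sawinDeg R, Finset.mul_sum]
  have h1 : ((Finset.univ.filter fun k : T → G => m ≤ sawinDeg k).card : ℝ) =
      ∑ k : T → G, if m ≤ sawinDeg k then (1 : ℝ) else 0 := by
    rw [Finset.sum_boole]
  rw [h1]
  refine Finset.sum_le_sum fun k _ => ?_
  split_ifs with hk
  · rw [← Real.rpow_natCast, ← Real.rpow_add hR0]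
    refine Real.one_le_rpow hR ?_
    have : (m : ℝ) ≤ sawinDeg k := by exact_mod_cast hk
    linarith
  · positivity

end Counting

/-! ## The constants (exponential-moment optimisation) -/

section Constants

/-- `(7/8)^{-3q/4} (1 - q/8) < 1` for `0 < q`: the lower-tail rate. [folklore] -/
theorem sawin_rate_one_lt {q : ℝ} (hq : 0 < q) :
    (7 / 8 : ℝ) ^ (-(3 * q / 4)) * (1 - q / 8) < 1 := by
  have hr : (0 : ℝ) < 7 / 8 := by norm_num
  have hlog : (1 : ℝ) - (7 / 8)⁻¹ ≤ Real.log (7 / 8) := Real.one_sub_inv_le_log_of_pos hr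
  have hexp : Real.log (7 / 8) * (3 * q / 4) + 1 ≤ (7 / 8 : ℝ) ^ (3 * q / 4) := by
    rw [Real.rpow_def_of_pos hr]
    exact Real.add_one_le_exp _
  have hpow : 1 - 3 * q / 28 ≤ (7 / 8 : ℝ) ^ (3 * q / 4) := by
    have : (1 : ℝ) - (7 / 8)⁻¹ = -(1 / 7) := by norm_num
    rw [this] at hlog
    nlinarith
  rw [Real.rpow_neg hr.le, inv_mul_eq_div, div_lt_one (Real.rpow_pos_of_pos hr _)]
  linarith

/-- `(5/4)^{-3q/2} (1 + q/4) < 1` for `0 < q`: the upper-tail rate. [folklore] -/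
theorem sawin_rate_two_lt {q : ℝ} (hq : 0 < q) :
    (5 / 4 : ℝ) ^ (-(3 * q / 2)) * (1 + q / 4) < 1 := by
  have hR : (0 : ℝ) < 5 / 4 := by norm_num
  have hlog : (1 : ℝ) - (5 / 4)⁻¹ ≤ Real.log (5 / 4) := Real.one_sub_inv_le_log_of_pos hR
  have hexp : Real.log (5 / 4) * (3 * q / 2) + 1 ≤ (5 / 4 : ℝ) ^ (3 * q / 2) := by
    rw [Real.rpow_def_of_pos hR]
    exact Real.add_one_le_exp _
  have hpow : 1 + 3 * q / 10 ≤ (5 / 4 : ℝ) ^ (3 * q / 2) := by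
    have : (1 : ℝ) - (5 / 4)⁻¹ = 1 / 5 := by norm_num
    rw [this] at hlog
    nlinarith
  rw [Real.rpow_neg hR.le, inv_mul_eq_div, div_lt_one (Real.rpow_pos_of_pos hR _)]
  linarith

end Constants

/-! ## Sawin 2018, Lemma 1.3 (general finite index set) -/

section Lemma13

variable {K : Type v} [Field K] {G : Type u} [Group G] [DecidableEq G] [Fintype G]

/-- **Sawin 2018, Lemma 1.3, uniform form**: if `char K ∣ |G|` there is `δ ∈ (0,1)`, depending
only on `|G|`, with `slice-rank_K D_{G^T} ≤ 3 δ^{|T|} |G|^{|T|}` for every finite `T`. The `δ` is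
`max((7/8)^{-3q/4}(1 - q/8), (5/4)^{-3q/2}(1 + q/4))`, `q = 1/|G|` (exponential moments of the
degree with threshold `a = ⌈3q|T|/4⌉`). [cite: Sawin2018, Lemma 1.3] -/
theorem exists_sliceRank_mulGroupTensor_pi_le (hG : (Fintype.card G : K) = 0) :
    ∃ δ : ℝ, 0 < δ ∧ δ < 1 ∧ ∀ (T : Type) [Fintype T] [DecidableEq T],
      (sliceRank (mulGroupTensor K (T → G)) : ℝ) ≤
        3 * δ ^ Fintype.card T * (Fintype.card G : ℝ) ^ Fintype.card T := by
  -- constants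
  have hGpos : (0 : ℝ) < Fintype.card G := by exact_mod_cast Fintype.card_pos
  set q : ℝ := 1 / (Fintype.card G : ℝ) with hq
  have hq0 : 0 < q := by positivity
  set A : ℝ := (Fintype.card G : ℝ) - 1 with hA
  have hA1 : 1 + A = Fintype.card G := by rw [hA]; ring
  set δ₁ : ℝ := (7 / 8 : ℝ) ^ (-(3 * q / 4)) * (1 - q / 8) with hδ₁
  set δ₂ : ℝ := (5 / 4 : ℝ) ^ (-(3 * q / 2)) * (1 + q / 4) with hδ₂
  have hδ₁1 : δ₁ < 1 := sawin_rate_one_lt hq0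
  have hδ₂1 : δ₂ < 1 := sawin_rate_two_lt hq0
  have hq1 : q ≤ 1 := by
    rw [hq, div_le_one hGpos]; exact_mod_cast Fintype.card_pos
  have hδ₁0 : 0 < δ₁ := by
    have : 0 < 1 - q / 8 := by linarith
    positivity
  have hδ₂0 : 0 < δ₂ := by positivity
  refine ⟨max δ₁ δ₂, lt_max_of_lt_left hδ₁0, max_lt hδ₁1 hδ₂1, fun T _ _ => ?_⟩
  set n : ℕ := Fintype.card T with hn
  set a : ℕ := ⌈3 * q * n / 4⌉₊ with ha
  have ha1 : (a : ℝ) < 3 * q * n / 4 + 1 := Nat.ceil_lt_add_one (by positivity)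
  have ha2 : 3 * q * n / 4 ≤ a := Nat.le_ceil _
  -- the combinatorial bound
  have hsr := (hasSliceRankLE_mulGroupTensor_pi (K := K) (G := G) (T := T) hG a).sliceRank_le
  have hsr' : (sliceRank (mulGroupTensor K (T → G)) : ℝ) ≤
      (Fintype.card {i : T → G // sawinDeg i < a} : ℝ) +
        (Fintype.card {i : T → G // sawinDeg i < a} : ℝ) +
        (Fintype.card {k : T → G // a + a ≤ sawinDeg k} : ℝ) := by exact_mod_cast hsr
  -- the two tails
  have hr0 : (0 : ℝ) < 7 / 8 := by norm_num
  have hR1 : (1 : ℝ) ≤ 5 / 4 := by norm_num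
  have h78 : (7 / 8 : ℝ) + A = (1 - q / 8) * Fintype.card G := by
    rw [hA, hq]; field_simp; ring
  have h54 : (5 / 4 : ℝ) + A = (1 + q / 4) * Fintype.card G := by
    rw [hA, hq]; field_simp; ring
  have htail1 : (Fintype.card {i : T → G // sawinDeg i < a} : ℝ) ≤
      δ₁ ^ n * (Fintype.card G : ℝ) ^ n := by
    refine (card_sawinDeg_lt_le hr0 (by norm_num) a).trans ?_
    rw [h78, ← hn]
    have h1 : (7 / 8 : ℝ) ^ ((1 : ℝ) - a) ≤ (7 / 8 : ℝ) ^ (-(3 * q / 4) * n) :=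
      Real.rpow_le_rpow_of_exponent_ge hr0 (by norm_num) (by linarith)
    calc (7 / 8 : ℝ) ^ ((1 : ℝ) - a) * ((1 - q / 8) * Fintype.card G) ^ n
        ≤ (7 / 8 : ℝ) ^ (-(3 * q / 4) * n) * ((1 - q / 8) * Fintype.card G) ^ n :=
          mul_le_mul_of_nonneg_right h1 (pow_nonneg (mul_nonneg (by linarith) hGpos.le) n)
      _ = δ₁ ^ n * (Fintype.card G : ℝ) ^ n := by
          rw [Real.rpow_mul_natCast hr0.le, hδ₁, mul_pow, mul_pow]; ring
  have htail2 : (Fintype.card {k : T → G // a + a ≤ sawinDeg k} : ℝ) ≤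
      δ₂ ^ n * (Fintype.card G : ℝ) ^ n := by
    refine (card_le_sawinDeg_le hR1 (a + a)).trans ?_
    rw [h54, ← hn]
    have h1 : (5 / 4 : ℝ) ^ (-((a + a : ℕ) : ℝ)) ≤ (5 / 4 : ℝ) ^ (-(3 * q / 2) * n) :=
      Real.rpow_le_rpow_of_exponent_le hR1 (by push_cast; linarith)
    calc (5 / 4 : ℝ) ^ (-((a + a : ℕ) : ℝ)) * ((1 + q / 4) * Fintype.card G) ^ n
        ≤ (5 / 4 : ℝ) ^ (-(3 * q / 2) * n) * ((1 + q / 4) * Fintype.card G) ^ n :=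
          mul_le_mul_of_nonneg_right h1 (by positivity)
      _ = δ₂ ^ n * (Fintype.card G : ℝ) ^ n := by
          rw [Real.rpow_mul_natCast (by norm_num), hδ₂, mul_pow, mul_pow]; ring
  -- assemble
  have hm1 : δ₁ ^ n ≤ (max δ₁ δ₂) ^ n := pow_le_pow_left₀ hδ₁0.le (le_max_left _ _) n
  have hm2 : δ₂ ^ n ≤ (max δ₁ δ₂) ^ n := pow_le_pow_left₀ hδ₂0.le (le_max_right _ _) n
  have hGn : (0 : ℝ) ≤ (Fintype.card G : ℝ) ^ n := by positivity
  calc (sliceRank (mulGroupTensor K (T → G)) : ℝ)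
      ≤ δ₁ ^ n * (Fintype.card G : ℝ) ^ n + δ₁ ^ n * (Fintype.card G : ℝ) ^ n +
          δ₂ ^ n * (Fintype.card G : ℝ) ^ n := by linarith
    _ ≤ (max δ₁ δ₂) ^ n * (Fintype.card G : ℝ) ^ n + (max δ₁ δ₂) ^ n * (Fintype.card G : ℝ) ^ n +
          (max δ₁ δ₂) ^ n * (Fintype.card G : ℝ) ^ n := by gcongr
    _ = 3 * (max δ₁ δ₂) ^ n * (Fintype.card G : ℝ) ^ n := by ring

end Lemma13

/-! ## Discharges: Sawin 2018, Lemma 1.3 and Theorem 1.5 -/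

section Discharge

/-- Powers of a multiplicative matching: from a matching in `G^n` indexed by `ι`, a matching in
`G^{k × n}` indexed by `ι^k` ("a multiplicative matching in `Gⁿ` of size `|S|` gives a
multiplicative matching in `G^{nk}` of size `|S|^k`", Sawin 2018, proof of Thm. 1.5).
[cite: Sawin2018, Thm. 1.5 (proof)] -/
theorem IsMulMatching.pow {G : Type u} [Group G] {ι : Type v} {n : ℕ} {s t u : ι → (Fin n → G)}
    (h : IsMulMatching s t u) (k : ℕ) :
    IsMulMatching (G := Fin k × Fin n → G) (ι := Fin k → ι) (fun I ab => s (I ab.1) ab.2)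
      (fun I ab => t (I ab.1) ab.2) (fun I ab => u (I ab.1) ab.2) := by
  intro I J L
  constructor
  · intro h1
    have hl : ∀ l, I l = J l ∧ J l = L l := fun l => (h (I l) (J l) (L l)).1 (by
      funext b
      have := congr_fun h1 (l, b)
      simpa using this)
    exact ⟨funext fun l => (hl l).1, funext fun l => (hl l).2⟩
  · rintro ⟨rfl, rfl⟩
    funext ⟨l, b⟩
    have := congr_fun (h.diag (I l)) b
    simpa using this

/-- **Sawin 2018, Lemma 1.3**, discharged: `Sawin2018_lem13` holds (with the `δ` of
`exists_sliceRank_mulGroupTensor_pi_le` for `K = 𝔽_p`, `p ∣ |G|`). [cite: Sawin2018, Lemma 1.3] -/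
theorem Sawin2018_lem13_holds : Sawin2018_lem13 := by
  intro G _ _ _ p _ hp
  have hG : (Fintype.card G : ZMod p) = 0 := (ZMod.natCast_eq_zero_iff _ _).2 hp
  obtain ⟨δ, -, hδ1, h⟩ := exists_sliceRank_mulGroupTensor_pi_le (K := ZMod p) hG
  refine ⟨δ, hδ1, fun n => ?_⟩
  simpa only [Fintype.card_fin] using h (Fin n)

/-- **Sawin 2018, Theorem 1.5**, discharged: `Sawin2018_thm15` holds. Proof as printed: a prime
`p ∣ |G|`, Lemma 1.3 over `𝔽_p` for the index sets `Fin k × Fin n`, Lemma 1.4 (= BCCGU Prop. 2.10,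
`IsMulMatching.card_le_sliceRank`) and the amplification `M ↦ M^k`, `k → ∞`.
[cite: Sawin2018, Thm. 1.5] -/
theorem Sawin2018_thm15_holds : Sawin2018_thm15 := by
  intro G _ _ hnt
  classical
  have hcard : Fintype.card G ≠ 1 := Fintype.one_lt_card.ne'
  obtain ⟨p, hp, hpG⟩ := Nat.exists_prime_and_dvd hcard
  haveI : Fact p.Prime := ⟨hp⟩
  have hG : (Fintype.card G : ZMod p) = 0 := (ZMod.natCast_eq_zero_iff _ _).2 hpG
  obtain ⟨δ, hδ0, hδ1, h⟩ := exists_sliceRank_mulGroupTensor_pi_le (K := ZMod p) hG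
  refine ⟨δ, hδ1, fun n ι _ s t u hM => ?_⟩
  have hGpos : (0 : ℝ) < Fintype.card G := by exact_mod_cast Fintype.card_pos
  have hy : 0 < δ ^ n * (Fintype.card G : ℝ) ^ n := by positivity
  refine Literature.Computability.AlgebraicComplexity.Combinatorics.le_of_pow_le_poly_mul_pow
    (c := 3) (d := 0) hy fun k _ => ?_
  have h1 := (hM.pow k).card_le_sliceRank (K := ZMod p)
  have h2 := h (Fin k × Fin n)
  rw [Fintype.card_prod, Fintype.card_fin, Fintype.card_fin] at h2
  rw [Fintype.card_fun, Fintype.card_fin] at h1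
  have h1' : ((Fintype.card ι : ℝ)) ^ k ≤
      (sliceRank (mulGroupTensor (ZMod p) (Fin k × Fin n → G)) : ℝ) := by exact_mod_cast h1
  calc (Fintype.card ι : ℝ) ^ k ≤ _ := h1'
    _ ≤ 3 * δ ^ (k * n) * (Fintype.card G : ℝ) ^ (k * n) := h2
    _ = 3 * ((k : ℝ) + 1) ^ 0 * (δ ^ n * (Fintype.card G : ℝ) ^ n) ^ k := by
        rw [pow_zero, mul_one, mul_pow, mul_comm k n, pow_mul, pow_mul, mul_assoc]

end Discharge

/-! ## Matchings compose along extensions — limits of the method for a fixed group (audit 2026-08-17, gen 2)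

Blasiak–Church–Cohn–Grochow–Umans 2017, App. A, Lemma A.5 ("Suppose we have a short exact
sequence `1 → N → G → G/N → 1`. Let `{sᵢ}, {tⱼ}, {u_k}` be a multiplicative matching of cardinality
`m` in `N` and let `{x_{i'}}, {y_{j'}}, {z_{k'}}` be a multiplicative matching of cardinality `m'` in
`G/N`. Then there is a multiplicative matching of cardinality `mm'` in `G`. The same statement holds
with 'multiplicative matching' replaced everywhere by 'border multiplicative matching'"; held text
`paper:arxiv-1712.02302`, p. 12, where the abridged numbering prints it as Lemma 40), honest part,
PROVED with the printed lifts: `x̃, ỹ` arbitrary lifts, `z̃ = (x̃ỹ)⁻¹`, and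
`f_{i,i'} = sᵢ x̃_{i'}`, `g_{j,j'} = t_j^{x̃_{j'}⁻¹} ỹ_{j'}`, `h_{k,k'} = u_k^{(x̃_{k'}ỹ_{k'})⁻¹} z̃_{k'}`.

Why it is recorded here (the adversarial side of conjunct (b) of `NilpotentGroupBarrier`). Every
slice-rank bound `slice-rank D_{G^T} ≤ C (δ|G|)^{|T|}` is at least the size of a multiplicative
matching (Prop. 2.10, `IsMulMatching.card_le_sliceRank`), so Sawin's `δ` for a fixed `G` can never
be taken below the matching capacity `δ_G^{match} = limsup_n m(Gⁿ)^{1/n}/|G|`, and by this lemma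
(applied in `Gⁿ ⊵ Nⁿ`, quotient `(G/N)ⁿ`) capacities are supermultiplicative along extensions:
`δ_G^{match} ≥ δ_N^{match} · δ_{G/N}^{match}`. With the Kleinberg–Sawin–Speyer capacities of the
cyclic groups (`m(C_qⁿ) ≥ θ_q^{n−o(n)}` for every integer `q ≥ 2`, `θ_q = min_ρ (1+ρ+⋯+ρ^{q−1})ρ^{−(q−1)/3}`,
tight against BCCGNSU Thm. A for prime powers [KleinbergSawinSpeyer2018, Thm. 2]) this gives, for a
fixed finite SOLVABLE `G` with composition factors `C_{p₁}, …, C_{p_r}`,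
`δ_G^{match} ≥ ∏ᵢ θ_{pᵢ}/pᵢ`; consequently the chain "slice rank ⟹ matchings ⟹ (2.2) at
`w = 2 + 2 log(1/δ)/log|G|`" (`Sawin2018_thm15_stpp`) can never force (2.2) below
`w₀(G) = 2 + 2 ∑ᵢ log(pᵢ/θ_{pᵢ})/log|G| ≤ 2 + 2·log(2/θ₂)/log 2 ≈ 2.163` (`θ₂ = 3/2^{2/3}`,
`θ₃ ≈ 2.755`, `θ₅ ≈ 4.46`, `θ₇ ≈ 6.16`; e.g. `S₃`: `δ ∈ [θ₂θ₃/6, θ₃/3] ≈ [0.868, 0.918]`,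
`w₀ ≤ 2.158`) — far below the current record `ω < 2.3714`: for fixed solvable `G` the entry is an
`ω = 2` barrier, not a record barrier (audit 2026-08-17, gen 2; recorded in the scope caveats of the
catalogue block of `NilpotentGroupBarrier.lean`).
-/

section Extension

variable {G : Type u} [Group G]

/-- **BCCGU 2017, Lemma A.5 (extensions), honest matchings — PROVED.** If `N ⊴ G`,
`(s̄, t̄, ū)` is a multiplicative matching in `G ⧸ N` indexed by `A` and `(a, b, c)` one in `N`
indexed by `L`, then for any lifts `S, T : A → G` of `s̄, t̄` (and the forced lift `(S T)⁻¹` of `ū`)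
the triple `s (α,l) = a_l · S_α`, `t (α,l) = T_α (S_α T_α)⁻¹ · b_l · (S_α T_α)`,
`u (α,l) = (S_α T_α)⁻¹ · c_l` is a multiplicative matching in `G` indexed by `A × L`: modulo `N` the
equation `s t u = 1` is `s̄_α t̄_β ū_γ = 1`, forcing `α = β = γ`, and then it reads `a_l b_m c_k = 1`
in `N`. (The printed lifts `sᵢx̃`, `t_j^{x̃⁻¹}ỹ`, `u_k^{(x̃ỹ)⁻¹}z̃` up to the side on which `N` is
written.) [cite: BlasiakChurchCohnGrochowUmans2017, Lemma A.5] -/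
theorem IsMulMatching.extension (N : Subgroup G) [N.Normal] {A : Type v} {L : Type*}
    {sq tq uq : A → G ⧸ N} (hQ : IsMulMatching sq tq uq) {a b c : L → N}
    (hN : IsMulMatching a b c) (S T : A → G) (hS : ∀ α, (S α : G ⧸ N) = sq α)
    (hT : ∀ α, (T α : G ⧸ N) = tq α) :
    IsMulMatching (G := G) (ι := A × L) (fun p => (a p.2 : G) * S p.1)
      (fun p => T p.1 * (S p.1 * T p.1)⁻¹ * (b p.2 : G) * (S p.1 * T p.1))
      (fun p => (S p.1 * T p.1)⁻¹ * (c p.2 : G)) := by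
  rintro ⟨α, l⟩ ⟨β, m⟩ ⟨γ, k⟩
  constructor
  · intro h
    -- modulo `N` the equation is `s̄_α t̄_β ū_γ = 1`
    have huq : ∀ γ, uq γ = (sq γ * tq γ)⁻¹ := fun γ =>
      eq_inv_of_mul_eq_one_right (hQ.diag γ)
    have ha : ((a l : G) : G ⧸ N) = 1 := (QuotientGroup.eq_one_iff _).2 (a l).2
    have hb : ((b m : G) : G ⧸ N) = 1 := (QuotientGroup.eq_one_iff _).2 (b m).2
    have hc : ((c k : G) : G ⧸ N) = 1 := (QuotientGroup.eq_one_iff _).2 (c k).2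
    have himg := congrArg (QuotientGroup.mk (s := N)) h
    simp only [QuotientGroup.mk_mul, QuotientGroup.mk_inv, QuotientGroup.mk_one, ha, hb, hc, hS, hT,
      one_mul, mul_one] at himg
    have hq : sq α * tq β * uq γ = 1 := by
      rw [huq, ← himg]; group
    obtain ⟨h1, h2⟩ := (hQ α β γ).1 hq
    subst h1; subst h2
    -- inside one fibre it is `a_l b_m c_k = 1` in `N`
    have h' : (a l : G) * (b m : G) * (c k : G) = 1 := by
      rw [← h]; group
    have h'' : a l * b m * c k = 1 := by
      apply Subtype.ext
      simpa using h'
    obtain ⟨h3, h4⟩ := (hN l m k).1 h''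
    subst h3; subst h4
    exact ⟨rfl, rfl⟩
  · rintro ⟨h1, h2⟩
    simp only [Prod.mk.injEq] at h1 h2
    obtain ⟨rfl, rfl⟩ := h1
    obtain ⟨rfl, rfl⟩ := h2
    have hd : ((a l * b l * c l : N) : G) = 1 := by rw [hN.diag l]; rfl
    have hd' : (a l : G) * (b l : G) * (c l : G) = 1 := by simpa using hd
    calc (a l : G) * S α * (T α * (S α * T α)⁻¹ * (b l : G) * (S α * T α)) * ((S α * T α)⁻¹ * (c l : G))
        = (a l : G) * (b l : G) * (c l : G) := by group
      _ = 1 := hd'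

/-- Lemma A.5, existence form: matchings in `N ⊴ G` indexed by `L` and in `G ⧸ N` indexed by `A`
give a matching in `G` indexed by `A × L` (lifts by `Quotient.out`).
[cite: BlasiakChurchCohnGrochowUmans2017, Lemma A.5] -/
theorem IsMulMatching.exists_extension (N : Subgroup G) [N.Normal] {A : Type v} {L : Type*}
    {sq tq uq : A → G ⧸ N} (hQ : IsMulMatching sq tq uq) {a b c : L → N}
    (hN : IsMulMatching a b c) :
    ∃ s t u : A × L → G, IsMulMatching s t u :=
  ⟨_, _, _, hQ.extension N hN (fun α => (sq α).out) (fun α => (tq α).out)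
    (fun α => (sq α).out_eq') (fun α => (tq α).out_eq')⟩

/-- **Limits of the method compose along extensions**: matchings in a normal subgroup `N` and in
`G ⧸ N` of cardinalities `|L|` and `|A|` force `|A|·|L| ≤ slice-rank_K D_G` over EVERY field `K`
(Lemma A.5 with Prop. 2.10 = `IsMulMatching.card_le_sliceRank`, whose universe convention
`K, ι : Type v` is kept). Applied to `Gⁿ ⊵ Nⁿ` this is the
supermultiplicativity `δ_G ≥ δ_N δ_{G/N}` of the densities below which no Sawin-type bound
`slice-rank D_{Gⁿ} ≤ C(δ|G|)ⁿ` can hold (see the section docstring for the solvable-group window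
`w₀(G) ≤ 2.163`). [cite: BlasiakChurchCohnGrochowUmans2017, Lemma A.5 and Prop. 2.10] -/
theorem IsMulMatching.card_mul_le_sliceRank_of_extension {K : Type v} [Field K] [Fintype G]
    [DecidableEq G] (N : Subgroup G) [N.Normal] {A : Type v} {L : Type v} [Fintype A] [Fintype L]
    {sq tq uq : A → G ⧸ N} (hQ : IsMulMatching sq tq uq) {a b c : L → N}
    (hN : IsMulMatching a b c) :
    Fintype.card A * Fintype.card L ≤ sliceRank (mulGroupTensor K G) := by
  classical
  obtain ⟨s, t, u, h⟩ := hQ.exists_extension N hN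
  simpa only [Fintype.card_prod] using h.card_le_sliceRank (K := K)

end Extension





end Literature.Barriers.MatrixMultiplication
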